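import Mathlib.RingTheory.Valuation.ValuationSubring
import Mathlib.RingTheory.Derivation.Basic
import Mathlib.RingTheory.LocalRing.MaximalIdeal.Basic
import Mathlib.Algebra.Algebra.Subalgebra.Basic
import HarnessLib

/-!
# Crux `Steer` (stmt-16345), chain W4.1: typed cores of the K4.1b non-vacuity certificate (C1)

OURS (campaign `res-hironaka`, rung L, slot W4.1; replaces the role of no printed item; NOT a statement
of the manuscript under review). Five elementary lemmas, kernel-checked by the chain's second triager
(res-L0-w41-tri-2, `K41b-lemmas.lean`) and landed here verbatim, that make the two «delicate» hypotheses of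
the registered Steer core `Sig.stub_steerDefectCore4` (line `switching_dichotomy`,
`Cruxes/Steer/Lines/switching_dichotomy.lean`) AUTOMATIC for the certificate datum of `CRUX-PLAN-Steer.md` §2:

* `defect_of_pDivisible` (= helper H2 of the crux plan): if every non-zero fraction of `A₀` has the value
  of a `p`-th power of a fraction of `A₀` (the value group of `Frac A₀` is `p`-divisible) and `t ^ p` is
  not a `p`-th power of a fraction of `A₀`, then the datum has DEFECT in the sense of the skeleton
  (`Defect O A₀ t p`, unfolded verbatim below).
* `valuation_eq_of_dense`, `discrete_of_dense_of_cyclic` (first half of helper H1): density of `K` in a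
  subfield `F₀` forces equal value sets; hence a dense subfield with cyclic values makes `O` discrete of
  rank one (`Discrete O`, unfolded verbatim).
* `derivation_mul_mem_maximalIdeal`, `not_isUnit_derivation_of_mem_sq` (hypothesis `hδ` of the core):
  an element of `𝔪 ^ 2` of a local ring has no unit `ℤ`-derivative.

Design: this helper imports NO `Theses.*` / `Cruxes.*` module (chain build rule, CHAIN W4.1 v2.1
§imports); the skeleton's vocabulary (`IsFracOf`, `Defect`, `Discrete`) is INLINED in the statements,
exactly as in the landed `Theorems.SwitchingDichotomy.switchingDefectlessSeq`, so the leaf consumes these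
lemmas by definitional unfolding. Sources: standard valuation theory (F.-V. Kuhlmann, *Defect*, 2010,
§2, for the notion of defect of a degree-`p` extension); the lemmas themselves are folklore.
-/

-- layout-mandated namespace `Summit.<Summit>.<Problem>.…` with Summit = Problem (single-conjunct summit)
set_option linter.dupNamespace false

namespace Summit.ResolutionOfSingularities.ResolutionOfSingularities.Theorems.SwitchingDichotomy

/-- **H2 (`p`-divisible values force defect).** Let `O` be a valuation ring of `K`, `A₀ ⊆ K` a
`k`-subalgebra and `t ^ p ∈ A₀`. If every non-zero fraction `x = y / z` of elements of `A₀` has the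
value of `w ^ p` for some fraction `w` of elements of `A₀`, and `t ^ p ≠ g ^ p` for every fraction `g`
of elements of `A₀`, then for every such `g` the error `t ^ p - g ^ p` has the value of a `p`-th power
of a fraction of `A₀` — the skeleton's `Defect O A₀ t p`, unfolded. [folklore] -/
theorem defect_of_pDivisible {k K : Type*} [Field k] [Field K] [Algebra k K] (O : ValuationSubring K)
    (A₀ : Subalgebra k K) (t : K) (p : ℕ) (htp : t ^ p ∈ A₀)
    (hdiv : ∀ x : K, (∃ y ∈ A₀, ∃ z ∈ A₀, z ≠ 0 ∧ x = y / z) → x ≠ 0 →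
      ∃ w : K, (∃ y ∈ A₀, ∃ z ∈ A₀, z ≠ 0 ∧ w = y / z) ∧ O.valuation x = O.valuation (w ^ p))
    (hnp : ∀ g : K, (∃ y ∈ A₀, ∃ z ∈ A₀, z ≠ 0 ∧ g = y / z) → t ^ p ≠ g ^ p) :
    ∀ g : K, (∃ y ∈ A₀, ∃ z ∈ A₀, z ≠ 0 ∧ g = y / z) →
      ∃ w : K, (∃ y ∈ A₀, ∃ z ∈ A₀, z ≠ 0 ∧ w = y / z) ∧
        O.valuation (t ^ p - g ^ p) = O.valuation (w ^ p) := by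
  intro g hg
  have hne : t ^ p - g ^ p ≠ 0 := sub_ne_zero.mpr (hnp g hg)
  have hfr : ∃ y ∈ A₀, ∃ z ∈ A₀, z ≠ 0 ∧ t ^ p - g ^ p = y / z := by
    obtain ⟨y, hy, z, hz, hz0, rfl⟩ := hg
    refine ⟨t ^ p * z ^ p - y ^ p, ?_, z ^ p, A₀.pow_mem hz p, pow_ne_zero _ hz0, ?_⟩
    · exact A₀.sub_mem (A₀.mul_mem htp (A₀.pow_mem hz p)) (A₀.pow_mem hy p)
    · rw [div_pow, eq_div_iff (pow_ne_zero _ hz0), sub_mul, div_mul_cancel₀ _ (pow_ne_zero _ hz0)]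
  exact hdiv _ hfr hne

/-- **Density forces equal values (first half of H1).** If every `x ∈ K` is approximable from the
subfield `F₀` to within any non-zero value (`v (x - a) < v w`), then every non-zero `x` has the value
of some `a ∈ F₀` (take `w := x`). [folklore] -/
theorem valuation_eq_of_dense {K : Type*} [Field K] (O : ValuationSubring K) (F₀ : Subfield K)
    (hd : ∀ x w : K, w ≠ 0 → ∃ a ∈ F₀, O.valuation (x - a) < O.valuation w) (x : K) (hx : x ≠ 0) :
    ∃ a ∈ F₀, O.valuation a = O.valuation x := by
  obtain ⟨a, ha, hlt⟩ := hd x x hx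
  refine ⟨a, ha, ?_⟩
  rw [Valuation.map_sub_swap] at hlt
  exact Valuation.map_eq_of_sub_lt _ hlt

/-- **A dense subfield with cyclic values makes `O` discrete of rank one.** If `K` is dense in `F₀`
(as in `valuation_eq_of_dense`), `π ≠ 0` has value `< 1`, and every non-zero `a ∈ F₀` has value an
integer power of `v π`, then every non-zero `z ∈ K` has value an integer power of `v π` — the
skeleton's `Discrete O`, unfolded. (Contrapositive use: a NON-finitely-generated value group admits no
dense subfield with cyclic values.) [folklore] -/
theorem discrete_of_dense_of_cyclic {K : Type*} [Field K] (O : ValuationSubring K) (F₀ : Subfield K)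
    (hd : ∀ x w : K, w ≠ 0 → ∃ a ∈ F₀, O.valuation (x - a) < O.valuation w)
    (π : K) (hπ0 : π ≠ 0) (hπ : O.valuation π < 1)
    (hcyc : ∀ a ∈ F₀, a ≠ 0 → ∃ n : ℤ, O.valuation a = O.valuation π ^ n) :
    ∃ π : K, π ≠ 0 ∧ O.valuation π < 1 ∧
      ∀ z : K, z ≠ 0 → ∃ n : ℤ, O.valuation z = O.valuation π ^ n := by
  refine ⟨π, hπ0, hπ, fun z hz => ?_⟩
  obtain ⟨a, ha, hav⟩ := valuation_eq_of_dense O F₀ hd z hz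
  have ha0 : a ≠ 0 := by
    rintro rfl
    rw [map_zero] at hav
    exact hz ((map_eq_zero O.valuation).mp hav.symm)
  obtain ⟨n, hn⟩ := hcyc a ha ha0
  exact ⟨n, hav ▸ hn⟩

/-- **Derivations send products of two non-units to non-units.** For a `ℤ`-derivation `δ` of a local
ring and `a, b ∈ 𝔪`: `δ (a * b) = a • δ b + b • δ a ∈ 𝔪`. [folklore] -/
theorem derivation_mul_mem_maximalIdeal {R : Type*} [CommRing R] [IsLocalRing R]
    (δ : Derivation ℤ R R) {a b : R} (ha : a ∈ IsLocalRing.maximalIdeal R)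
    (hb : b ∈ IsLocalRing.maximalIdeal R) : δ (a * b) ∈ IsLocalRing.maximalIdeal R := by
  rw [Derivation.leibniz, smul_eq_mul, smul_eq_mul]
  exact add_mem (Ideal.mul_mem_right _ _ ha) (Ideal.mul_mem_right _ _ hb)

/-- **Hypothesis `hδ` of the Steer core, in the shape it is used: an element of `𝔪 ^ 2` has no unit
`ℤ`-derivative.** For a local ring `R`, `f ∈ 𝔪 ^ 2` and any `ℤ`-derivation `δ : R → R`, `δ f ∈ 𝔪`, so
`δ f` is not a unit. (For the certificate datum: `t ^ p = y₁ y₂ + y₃ ^ (p + 1) ∈ 𝔪 ²`, whereas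
`t ^ p = y₁` would fail — `∂/∂y₁` gives a unit, the monogenic exit.) [folklore] -/
theorem not_isUnit_derivation_of_mem_sq {R : Type*} [CommRing R] [IsLocalRing R]
    (δ : Derivation ℤ R R) {f : R} (hf : f ∈ (IsLocalRing.maximalIdeal R) ^ 2) :
    ¬ IsUnit (δ f) := by
  have : δ f ∈ IsLocalRing.maximalIdeal R := by
    rw [pow_two] at hf
    refine Submodule.mul_induction_on hf (fun a ha b hb => derivation_mul_mem_maximalIdeal δ ha hb) ?_
    intro x y hx hy
    rw [map_add]
    exact add_mem hx hy
  exact (IsLocalRing.mem_maximalIdeal _).mp this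

end Summit.ResolutionOfSingularities.ResolutionOfSingularities.Theorems.SwitchingDichotomy
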